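import Literature.Probability.Percolation.HalfAnnulusQuadLatticeCrossing
import HarnessLib

/-!
# A Schramm–Smirnov crossing of the half-annulus quad is shadowed by a lattice crossing

Topic `Literature/Probability/Percolation`; proofs only (no definition, no named fact). Sequel of
`HalfAnnulusQuadLatticeCrossing.lean` (same setting and local notation: a conformal rectangle `R`
seen by the lattice drawn by `meshPoint δ v = c (X v + i Y v) / ρ` as `c · {0 ≤ im, 1 ≤ ‖·‖_∞ ≤ L}`
with sides `0`, `2` the inner/outer half-squares), giving the converse half of the dictionary
(O. Schramm, S. Smirnov, Ann. Probab. 39 (2011), §1.3: "in the discrete setting there is no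
difference between connected and path-connected crossings"):

* `latticePath_of_quadCrossing` — every `ω ∈ quadCrossing R δ` has an open lattice path from
  sup-radius `< ρ + 2` to `> Lρ - 2` through sites with `Y ≥ -1` (the ends of the open edges drawn
  through the continuum crossing, chained by `openConnIn_of_isPreconnected_subset_openEdgeUnion`);
* `quadCrossingProb_le_real_latticeCrossing` — after a unit lattice translation back into the
  half-plane `{Y ≥ 0}` and clipping: `P[𝒞_δ(R)] ≤ P(E₀[r₂, R₂])` for `ρ + 3 ≤ r₂ ≤ R₂ ≤ Lρ - 3`.

## References

* O. Schramm, S. Smirnov, Ann. Probab. 39 (2011), §1.3. [SchrammSmirnov2011]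
* H. Duminil-Copin, K. K. Kozlowski, D. Krachun, I. Manolescu, M. Oulamara, arXiv:2012.11672v1,
  §1.2. [DKKMO2020Rotational]
-/

noncomputable section

namespace Literature.Probability.Percolation

open MeasureTheory Set LatticeModels Complex Metric
open Literature.Probability.RandomPlanarGeometry

namespace HalfPlaneArm

variable {X Y : Site 2 → ℤ}

local notation3 "ν₀[" v "]" => max |X v| (Y v)
local notation3 "ann₀[" r ", " R "]" => {v : Site 2 | 0 ≤ Y v ∧ r ≤ ν₀[v] ∧ ν₀[v] ≤ R}
local notation3 "E₀[" r ", " R "]" =>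
  openCrossing ann₀[r, R] {v : Site 2 | ν₀[v] = r} {v : Site 2 | ν₀[v] = R}
local notation3 "pt[" v "]" => ((X v : ℂ) + (Y v : ℂ) * Complex.I)
/-- The sup-norm of a complex number (local). -/
local notation3 "sn[" w "]" => max |Complex.re w| |Complex.im w|
local notation3 "Hann[" L "]" => {w : ℂ | 0 ≤ w.im ∧ 1 ≤ sn[w] ∧ sn[w] ≤ L}
local notation3 "Iarc" => {w : ℂ | 0 ≤ w.im ∧ sn[w] = 1}
local notation3 "Oarc[" L "]" => {w : ℂ | 0 ≤ w.im ∧ sn[w] = L}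

section Shadow

variable (hX : ∀ u v, (zdGraph 2).Adj u v → X v ≤ X u + 1) (hY : ∀ u v, (zdGraph 2).Adj u v → Y v ≤ Y u + 1)

/-- **A crossing of the quad is shadowed by an open lattice path.** With `R`, `c`, `ρ`, `δ` as in
`quadCrossing_of_latticeCrossing` and `ρ δ < 2 ‖c‖` (the pulled-back edges are shorter than `2`),
every `ω ∈ quadCrossing R δ` has an open lattice path from a site of sup-norm `< ρ + 2` to a site of
sup-norm `> Lρ - 2` through sites with `Y ≥ -1` and sup-norm in `(ρ - 2, Lρ + 2)`: the ends of the
open edges drawn through the continuum crossing are within sup-distance `2` (in the `X, Y`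
coordinates) of points of `ρ · H_L`, and they are chained by an open lattice path
(`openConnIn_of_isPreconnected_subset_openEdgeUnion`).
[cite: SchrammSmirnov2011, §1.3 ("no difference between connected and path-connected crossings")] -/
theorem latticePath_of_quadCrossing {R : ConformalRectangle} {c : ℂ} {ρ δ L : ℝ} (hc : c ≠ 0)
    (hρ : 0 < ρ) (hδ : 0 < δ) (hκ : ρ * δ < 2 * ‖c‖)
    (hcl : closure R.carrier = (fun w => c * w) '' Hann[L])
    (h0 : R.arc 0 = (fun w => c * w) '' Iarc) (h2 : R.arc 2 = (fun w => c * w) '' Oarc[L])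
    (hmesh : ∀ v : Site 2, meshPoint δ v = c * pt[v] / ρ)
    {ω : BondConfig (Site 2)} (h : ω ∈ quadCrossing R δ) :
    ∃ x y : Site 2, ((max |X x| |Y x| : ℤ) : ℝ) < ρ + 2 ∧ L * ρ - 2 < ((max |X y| |Y y| : ℤ) : ℝ) ∧
      ω ∈ openConnIn {v : Site 2 | -1 ≤ Y v ∧ ρ - 2 < ((max |X v| |Y v| : ℤ) : ℝ) ∧
        ((max |X v| |Y v| : ℤ) : ℝ) < L * ρ + 2} x y := by
  obtain ⟨a, ha, b, hb, hJ⟩ := h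
  set γ := hJ.somePath with hγ
  have hγmem : ∀ t, γ t ∈ closure R.carrier ∩ openEdgeUnion δ ω := hJ.somePath_mem
  set Γ : ℝ → ℂ := fun t => γ (projIcc 0 1 zero_le_one t) with hΓ
  have hΓc : Continuous Γ := γ.continuous.comp continuous_projIcc
  set K := Γ '' Icc 0 1 with hK
  have hKc : IsCompact K := isCompact_Icc.image hΓc
  have hKconn : IsPreconnected K := isPreconnected_Icc.image Γ hΓc.continuousOn
  have hKO : K ⊆ openEdgeUnion δ ω := by rintro _ ⟨t, -, rfl⟩; exact (hγmem _).2
  have hKC : K ⊆ (fun w => c * w) '' Hann[L] := by rintro _ ⟨t, -, rfl⟩; rw [← hcl]; exact (hγmem _).1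
  have haK : a ∈ K := ⟨0, left_mem_Icc.2 zero_le_one, by simp only [hΓ, projIcc_left]; exact γ.source⟩
  have hbK : b ∈ K := ⟨1, right_mem_Icc.2 zero_le_one, by simp only [hΓ, projIcc_right]; exact γ.target⟩
  have cast_pt : ∀ v : Site 2, max |(X v : ℝ)| |(Y v : ℝ)| = ((max |X v| |Y v| : ℤ) : ℝ) := fun v => by
    push_cast; rfl
  -- the ends of the open edges drawn through `K`
  have hS : ∀ p ∈ edgePairs δ ω K, p.1 ∈ {v : Site 2 | -1 ≤ Y v ∧ ρ - 2 < ((max |X v| |Y v| : ℤ) : ℝ) ∧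
      ((max |X v| |Y v| : ℤ) : ℝ) < L * ρ + 2} := by
    rintro ⟨v, w⟩ ⟨hadj, -, z, hzs, hzK⟩
    obtain ⟨u', ⟨hu'0, hu'1, hu'2⟩, hTu⟩ := T_image (ρ := ρ) hc (hKC hzK)
    have hlt := norm_pt_sub_T_lt hc hρ hδ hmesh hκ hadj hzs
    rw [hTu] at hlt
    obtain ⟨-, hy, hsn⟩ := coords_of_norm_lt hlt
    rw [cast_pt, sn_real_mul hρ.le, abs_lt] at hsn
    rw [im_ofReal_mul, abs_lt] at hy
    refine ⟨?_, ?_, ?_⟩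
    · have h1 : (0 : ℝ) ≤ ρ * u'.im := mul_nonneg hρ.le hu'0
      have h2 : ((-2 : ℤ) : ℝ) < (Y v : ℝ) := by push_cast; linarith
      have h3 := Int.cast_lt.1 h2
      show -1 ≤ Y v
      omega
    · nlinarith
    · nlinarith
  obtain ⟨p₀, hp₀, h0s⟩ := exists_mem_edgePairs_of_mem hKO haK
  obtain ⟨p₁, hp₁, h1s⟩ := exists_mem_edgePairs_of_mem hKO hbK
  have hconn := openConnIn_of_isPreconnected_subset_openEdgeUnion hδ hKc hKconn hKO hS hp₀ hp₁
  refine ⟨p₀.1, p₁.1, ?_, ?_, hconn⟩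
  · rw [h0] at ha
    obtain ⟨u', ⟨-, hu'1⟩, hTu⟩ := T_image (ρ := ρ) hc ha
    have hlt := norm_pt_sub_T_lt hc hρ hδ hmesh hκ hp₀.1 h0s
    rw [hTu] at hlt
    obtain ⟨-, -, hsn⟩ := coords_of_norm_lt hlt
    rw [cast_pt, sn_real_mul hρ.le, hu'1, mul_one, abs_lt] at hsn
    linarith
  · rw [h2] at hb
    obtain ⟨u', ⟨-, hu'1⟩, hTu⟩ := T_image (ρ := ρ) hc hb
    have hlt := norm_pt_sub_T_lt hc hρ hδ hmesh hκ hp₁.1 h1s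
    rw [hTu] at hlt
    obtain ⟨-, -, hsn⟩ := coords_of_norm_lt hlt
    rw [cast_pt, sn_real_mul hρ.le, hu'1, abs_lt] at hsn
    linarith

include hX hY in
/-- **`P[𝒞_δ(Q)] ≤ P[lattice crossing of a slightly narrower half-annulus]`.** With `R`, `c`, `ρ`,
`δ` as above and a lattice symmetry `τ` of `ℤ²` raising `Y` by one and shifting `X` by at most one
(translating the shadow path of `latticePath_of_quadCrossing` back into the half-plane `{Y ≥ 0}`),
for integers `ρ + 3 ≤ r₂ ≤ R₂ ≤ Lρ - 3` the crossing probability of the quad is at most the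
probability of an open crossing of the lattice half-annulus `{0 ≤ Y, r₂ ≤ max |X| Y ≤ R₂}` (clip the
translated path at the levels `r₂`, `R₂` of the `1`-Lipschitz sup-norm). [cite: SchrammSmirnov2011, §1.3] -/
theorem quadCrossingProb_le_real_latticeCrossing {R : ConformalRectangle} {c : ℂ} {ρ δ L : ℝ}
    (hc : c ≠ 0) (hρ : 0 < ρ) (hδ : 0 < δ) (hκ : ρ * δ < 2 * ‖c‖)
    (hcl : closure R.carrier = (fun w => c * w) '' Hann[L])
    (h0 : R.arc 0 = (fun w => c * w) '' Iarc) (h2 : R.arc 2 = (fun w => c * w) '' Oarc[L])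
    (hmesh : ∀ v : Site 2, meshPoint δ v = c * pt[v] / ρ)
    (τ : zdGraph 2 ≃g zdGraph 2) {tX : ℤ} (htX : |tX| ≤ 1) (hτX : ∀ v, X (τ v) = X v + tX)
    (hτY : ∀ v, Y (τ v) = Y v + 1) {r₂ R₂ : ℤ} (hr₂ : ρ + 3 ≤ r₂) (hr₂R₂ : r₂ ≤ R₂)
    (hR₂ : (R₂ : ℝ) ≤ L * ρ - 3) :
    quadCrossingProb δ R ≤ (bondPercolation (zdGraph 2) half).real E₀[r₂, R₂] := by
  set S : Set (Site 2) := {v : Site 2 | -1 ≤ Y v ∧ ρ - 2 < ((max |X v| |Y v| : ℤ) : ℝ) ∧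
    ((max |X v| |Y v| : ℤ) : ℝ) < L * ρ + 2} with hSdef
  set A : Set (Site 2) := {v : Site 2 | ((max |X v| |Y v| : ℤ) : ℝ) < ρ + 2} with hAdef
  set B : Set (Site 2) := {v : Site 2 | L * ρ - 2 < ((max |X v| |Y v| : ℤ) : ℝ)} with hBdef
  have step1 : quadCrossingProb δ R ≤ (bondPercolation (zdGraph 2) half).real (openCrossing S A B) := by
    refine measureReal_mono (fun ω hω => ?_) (measure_ne_top _ _)
    obtain ⟨x, y, hx, hy, hxy⟩ := latticePath_of_quadCrossing hc hρ hδ hκ hcl h0 h2 hmesh hω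
    exact ⟨x, hx, y, hy, hxy⟩
  rw [← bondPercolation_real_image τ half S A B] at step1
  refine step1.trans (ENNReal.toReal_mono (measure_ne_top _ _) (measure_mono_ae ?_))
  filter_upwards [ae_subset_edgeSet (zdGraph 2) half] with ω hω h
  obtain ⟨x', ⟨x, hx, rfl⟩, y', ⟨y, hy, rfl⟩, hxy⟩ := h
  have memS : ∀ v, τ v ∈ τ '' S → v ∈ S := fun v ⟨w, hw, he⟩ => τ.injective he ▸ hw
  -- the translated sup-norm
  have key : ∀ v : Site 2, -1 ≤ Y v →
      0 ≤ Y (τ v) ∧ ν₀[τ v] ≤ max |X v| |Y v| + 1 ∧ max |X v| |Y v| ≤ ν₀[τ v] + 1 := fun v hv => by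
    rw [hτX, hτY]
    have t1 : |X v + tX| ≤ |X v| + 1 := (abs_add_le _ _).trans (by omega)
    have t2 : |X v| ≤ |X v + tX| + 1 := by
      have h' : |X v| ≤ |X v + tX| + |tX| := by
        calc |X v| = |(X v + tX) - tX| := by ring_nf
          _ ≤ |X v + tX| + |tX| := abs_sub _ _
      omega
    have t3 : |Y v| ≤ Y v + 2 := by rw [abs_le]; omega
    refine ⟨by omega, max_le ?_ ?_, max_le ?_ ?_⟩
    · exact t1.trans (add_le_add (le_max_left _ _) le_rfl)
    · exact (show Y v + 1 ≤ |Y v| + 1 by linarith [le_abs_self (Y v)]).trans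
        (add_le_add (le_max_right _ _) le_rfl)
    · exact t2.trans (add_le_add (le_max_left _ _) le_rfl)
    · exact t3.trans (by linarith [le_max_right |X v + tX| (Y v + 1)])
  have hxS : x ∈ S := memS x hxy.1
  have hyS : y ∈ S := memS y hxy.2.1
  have hx' : ν₀[τ x] ≤ r₂ := by
    have hxA : ((max |X x| |Y x| : ℤ) : ℝ) < ρ + 2 := hx
    obtain ⟨-, k, -⟩ := key x hxS.1
    have : ((max |X x| |Y x| : ℤ) : ℝ) < ((r₂ - 1 : ℤ) : ℝ) := by
      rw [Int.cast_sub, Int.cast_one]; linarith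
    have := Int.cast_lt.1 this
    omega
  have hy' : R₂ ≤ ν₀[τ y] := by
    have hyB : L * ρ - 2 < ((max |X y| |Y y| : ℤ) : ℝ) := hy
    obtain ⟨-, -, k⟩ := key y hyS.1
    have : ((R₂ + 1 : ℤ) : ℝ) < ((max |X y| |Y y| : ℤ) : ℝ) := by
      rw [Int.cast_add, Int.cast_one]; linarith
    have := Int.cast_lt.1 this
    omega
  obtain ⟨x₁, y₁, hx₁, hy₁, hconn⟩ := exists_openConnIn_clip hω (fun v => ν₀[v]) (supNorm_le_of_adj hX hY)
    (a := r₂) (b := R₂) hr₂R₂ hx' hy' hxy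
  refine ⟨x₁, hx₁, y₁, hy₁, openConnIn_mono ?_ _ _ hconn⟩
  rintro v' ⟨⟨v, hv, rfl⟩, hv1, hv2⟩
  exact ⟨(key v hv.1).1, hv1, hv2⟩

end Shadow

end HalfPlaneArm

end Literature.Probability.Percolation
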